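import Literature.MathematicalPhysics.QuantumManyBody.JelliumLemma52
import HarnessLib

/-!
# The exchange-block bound of Lieb–Solovej Lemma 5.4 in first quantization

Topic `Literature/MathematicalPhysics/QuantumManyBody` (the charged Bose gas, `JelliumBoseGas.foldyLaw`).
[LiebSolovej2001, Lemma 5.4, (5.?)]: `∑_{p,p'≠0} ŵ_{p0,0p'} a*_p a_{p'} ≤ 4πℓ⁻³R² n̂₊` — the one-body
operator with integral kernel `ℓ⁻³w(x,y)` sandwiched between `Q`'s has norm at most
`ℓ⁻³ sup_x∫w(x,y)dy ≤ 4πℓ⁻³R²`. In first quantization the corresponding blocks of the pair term are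
`⟨QᵢPⱼΨ, w(xᵢ,xⱼ) PᵢQⱼΨ⟩` (`i ≠ j`), products of a function independent of `xⱼ` with one independent
of `xᵢ` against the weight `w(xᵢ,xⱼ)`. For such products AM–GM and the dummy integrations of
`JelliumLemma52.lean` give the Schur-type bound

`2∫_{Λⁿ} w(xᵢ,xⱼ)|F||G| ≤ ℓ⁻³ M (‖F‖² + ‖G‖²)`,  `M = max(sup_x∫_Λ w(x,y)dy, sup_y∫_Λ w(x,y)dx)`

(`lintegral_cellN_kernel_mul_mul_le`), and summing over `i ≠ j` with `F = PⱼQᵢΨ`, `G = PᵢQⱼΨ` the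
bound of the exchange blocks by `ℓ⁻³M ∑_{i≠j}‖PⱼQᵢΨ‖²`-type quantities (`exchange_blocks_le`), which
`sum_weight_identity` (`JelliumLemma53.lean`, `m ≡ 1`) bounds by `ℓ⁻³M(n-1)⟨n̂₊⟩`.

## References

* [LiebSolovej2001] E. H. Lieb, J. P. Solovej, Commun. Math. Phys. 217 (2001) 127–163, Lemma 5.4
  (arXiv:cond-mat/0007425, p. 12).
-/

noncomputable section

open MeasureTheory Set Filter Real
open scoped ENNReal NNReal Topology

namespace Literature.MathematicalPhysics.QuantumManyBody.JelliumBoseGas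

open BoseGas

variable {n : ℕ} {ℓ : ℝ}

/-- **Schur-type bound for a product of one-variable-free functions**: for `i ≠ j`, a jointly
measurable kernel `w ≥ 0` with `∫_Λ w(x,y)dy ≤ M` (all `x`) and `∫_Λ w(x,y)dx ≤ M` (all `y`),
continuous `F` independent of `xⱼ` and `G` independent of `xᵢ` (`ℓ > 0`):
`2∫_{Λⁿ} w(xᵢ,xⱼ)|F||G| ≤ ℓ⁻³M(‖F‖² + ‖G‖²)`. [cite: LiebSolovej2001, Lemma 5.4 (proof)] -/
theorem lintegral_cellN_kernel_mul_mul_le (hℓ : 0 < ℓ) {i j : Fin n} (hij : i ≠ j)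
    {w : Space → Space → ℝ≥0∞} (hw : Measurable (Function.uncurry w)) {M : ℝ≥0∞}
    (h1 : ∀ x, ∫⁻ y in cell ℓ, w x y ≤ M) (h2 : ∀ y, ∫⁻ x in cell ℓ, w x y ≤ M)
    {F G : Config n → ℂ} (hF : Continuous F) (hG : Continuous G)
    (hFj : ∀ X z, F (Function.update X j z) = F X) (hGi : ∀ X z, G (Function.update X i z) = G X) :
    2 * ∫⁻ X in cellN n ℓ, w (X i) (X j) * ((‖F X‖₊ : ℝ≥0∞) * ‖G X‖₊) ≤
      (ENNReal.ofReal ℓ ^ 3)⁻¹ * M * ((∫⁻ X in cellN n ℓ, (‖F X‖₊ : ℝ≥0∞) ^ 2) +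
        ∫⁻ X in cellN n ℓ, (‖G X‖₊ : ℝ≥0∞) ^ 2) := by
  -- pointwise AM–GM
  have hamgm : ∀ p q : ℝ≥0∞, 2 * (p * q) ≤ p ^ 2 + q ^ 2 := by
    intro p q
    rcases eq_or_ne p ⊤ with rfl | hp
    · simp
    rcases eq_or_ne q ⊤ with rfl | hq
    · simp
    lift p to ℝ≥0 using hp
    lift q to ℝ≥0 using hq
    have h : (2 : ℝ≥0) * (p * q) ≤ p ^ 2 + q ^ 2 := by
      rw [← NNReal.coe_le_coe]; push_cast; nlinarith [sq_nonneg ((p : ℝ) - q)]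
    exact_mod_cast h
  have hpt : ∀ X : Config n, 2 * (w (X i) (X j) * ((‖F X‖₊ : ℝ≥0∞) * ‖G X‖₊)) ≤
      w (X i) (X j) * (‖F X‖₊ : ℝ≥0∞) ^ 2 + w (X i) (X j) * (‖G X‖₊ : ℝ≥0∞) ^ 2 := by
    intro X
    calc 2 * (w (X i) (X j) * ((‖F X‖₊ : ℝ≥0∞) * ‖G X‖₊))
        = w (X i) (X j) * (2 * ((‖F X‖₊ : ℝ≥0∞) * ‖G X‖₊)) := by ring
      _ ≤ w (X i) (X j) * ((‖F X‖₊ : ℝ≥0∞) ^ 2 + (‖G X‖₊ : ℝ≥0∞) ^ 2) := by gcongr; exact hamgm _ _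
      _ = _ := by ring
  -- measurability of the integrand
  have hwij : Measurable fun X : Config n => w (X i) (X j) := by
    have e : (fun X : Config n => w (X i) (X j)) = Function.uncurry w ∘ fun X : Config n => (X i, X j) := rfl
    rw [e]; exact hw.comp (by fun_prop)
  have hint : Measurable fun X : Config n => w (X i) (X j) * ((‖F X‖₊ : ℝ≥0∞) * ‖G X‖₊) :=
    hwij.mul (hF.measurable.nnnorm.coe_nnreal_ennreal.mul hG.measurable.nnnorm.coe_nnreal_ennreal)
  have hintF : Measurable fun X : Config n => w (X i) (X j) * (‖F X‖₊ : ℝ≥0∞) ^ 2 :=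
    hwij.mul (hF.measurable.nnnorm.coe_nnreal_ennreal.pow_const _)
  -- the `F`-term: integrate out `xⱼ`
  have hgF : Measurable (Function.uncurry fun (X : Config n) (y : Space) => w (X i) y) := by
    have e : (Function.uncurry fun (X : Config n) (y : Space) => w (X i) y) =
        Function.uncurry w ∘ fun p : Config n × Space => (p.1 i, p.2) := rfl
    rw [e]; exact hw.comp (by fun_prop)
  have eF := lintegral_cellN_weight_of_update_invariant hℓ j (g := fun X y => w (X i) y) hgF
    (fun X y z => by simp only [Function.update_of_ne hij]) hF.measurable hFj
  have hFle : ∫⁻ X in cellN n ℓ, w (X i) (X j) * (‖F X‖₊ : ℝ≥0∞) ^ 2 ≤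
      (ENNReal.ofReal ℓ ^ 3)⁻¹ * M * ∫⁻ X in cellN n ℓ, (‖F X‖₊ : ℝ≥0∞) ^ 2 := by
    rw [eF, mul_assoc, ← lintegral_const_mul _ (hF.measurable.nnnorm.coe_nnreal_ennreal.pow_const _)]
    gcongr with X
    exact h1 _
  -- the `G`-term: integrate out `xᵢ`
  have hgG : Measurable (Function.uncurry fun (X : Config n) (y : Space) => w y (X j)) := by
    have e : (Function.uncurry fun (X : Config n) (y : Space) => w y (X j)) =
        Function.uncurry w ∘ fun p : Config n × Space => (p.2, p.1 j) := rfl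
    rw [e]; exact hw.comp (by fun_prop)
  have eG := lintegral_cellN_weight_of_update_invariant hℓ i (g := fun X y => w y (X j)) hgG
    (fun X y z => by simp only [Function.update_of_ne (Ne.symm hij)]) hG.measurable hGi
  have hGle : ∫⁻ X in cellN n ℓ, w (X i) (X j) * (‖G X‖₊ : ℝ≥0∞) ^ 2 ≤
      (ENNReal.ofReal ℓ ^ 3)⁻¹ * M * ∫⁻ X in cellN n ℓ, (‖G X‖₊ : ℝ≥0∞) ^ 2 := by
    rw [eG, mul_assoc, ← lintegral_const_mul _ (hG.measurable.nnnorm.coe_nnreal_ennreal.pow_const _)]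
    gcongr with X
    exact h2 _
  -- assemble
  calc 2 * ∫⁻ X in cellN n ℓ, w (X i) (X j) * ((‖F X‖₊ : ℝ≥0∞) * ‖G X‖₊)
      = ∫⁻ X in cellN n ℓ, 2 * (w (X i) (X j) * ((‖F X‖₊ : ℝ≥0∞) * ‖G X‖₊)) := by
        rw [lintegral_const_mul _ hint]
    _ ≤ ∫⁻ X in cellN n ℓ, (w (X i) (X j) * (‖F X‖₊ : ℝ≥0∞) ^ 2 + w (X i) (X j) * (‖G X‖₊ : ℝ≥0∞) ^ 2) :=
        lintegral_mono fun X => hpt X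
    _ = (∫⁻ X in cellN n ℓ, w (X i) (X j) * (‖F X‖₊ : ℝ≥0∞) ^ 2) +
          ∫⁻ X in cellN n ℓ, w (X i) (X j) * (‖G X‖₊ : ℝ≥0∞) ^ 2 := lintegral_add_left hintF _
    _ ≤ (ENNReal.ofReal ℓ ^ 3)⁻¹ * M * (∫⁻ X in cellN n ℓ, (‖F X‖₊ : ℝ≥0∞) ^ 2) +
          (ENNReal.ofReal ℓ ^ 3)⁻¹ * M * ∫⁻ X in cellN n ℓ, (‖G X‖₊ : ℝ≥0∞) ^ 2 := add_le_add hFle hGle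
    _ = _ := by rw [mul_add]

/-- **The exchange blocks are bounded by `ℓ⁻³M·(∑_{i≠j}‖PⱼQᵢΨ‖² + ∑_{i≠j}‖PᵢQⱼΨ‖²)`**
[LiebSolovej2001, Lemma 5.4: `∑ŵ_{p0,0p'}a*a ≤ 4πℓ⁻³R²n̂₊`], first-quantized expectation form: for
continuous `Ψ`, `ℓ > 0`, and a jointly measurable kernel `w ≥ 0` with row and column integrals
`≤ M` (`M = 4πR²` for `w_{r,R}`),
`2∑_{i≠j}∫_{Λⁿ} w(xᵢ,xⱼ)|PⱼQᵢΨ||PᵢQⱼΨ| ≤ ℓ⁻³M(∑_{i≠j}‖PⱼQᵢΨ‖² + ∑_{i≠j}‖PᵢQⱼΨ‖²)`.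
[cite: LiebSolovej2001, Lemma 5.4] -/
theorem exchange_blocks_le (hℓ : 0 < ℓ) {w : Space → Space → ℝ≥0∞} (hw : Measurable (Function.uncurry w))
    {M : ℝ≥0∞} (h1 : ∀ x, ∫⁻ y in cell ℓ, w x y ≤ M) (h2 : ∀ y, ∫⁻ x in cell ℓ, w x y ≤ M)
    {Ψ : Config n → ℂ} (hΨ : Continuous Ψ) :
    2 * ∑ i : Fin n, ∑ j ∈ Finset.univ.erase i, ∫⁻ X in cellN n ℓ, w (X i) (X j) *
        ((‖sliceMean ℓ j (sliceFluct ℓ i Ψ) X‖₊ : ℝ≥0∞) * ‖sliceMean ℓ i (sliceFluct ℓ j Ψ) X‖₊) ≤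
      (ENNReal.ofReal ℓ ^ 3)⁻¹ * M *
        ((∑ i : Fin n, ∑ j ∈ Finset.univ.erase i,
            ∫⁻ X in cellN n ℓ, (‖sliceMean ℓ j (sliceFluct ℓ i Ψ) X‖₊ : ℝ≥0∞) ^ 2) +
          ∑ i : Fin n, ∑ j ∈ Finset.univ.erase i,
            ∫⁻ X in cellN n ℓ, (‖sliceMean ℓ i (sliceFluct ℓ j Ψ) X‖₊ : ℝ≥0∞) ^ 2) := by
  rw [Finset.mul_sum, ← Finset.sum_add_distrib, Finset.mul_sum]
  refine Finset.sum_le_sum fun i _ => ?_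
  rw [Finset.mul_sum, ← Finset.sum_add_distrib, Finset.mul_sum]
  refine Finset.sum_le_sum fun j hj => ?_
  have hij : i ≠ j := (Finset.ne_of_mem_erase hj).symm
  have hF : Continuous (sliceMean ℓ j (sliceFluct ℓ i Ψ)) :=
    continuous_sliceMean ℓ j (continuous_sliceFluct ℓ i hΨ)
  have hG : Continuous (sliceMean ℓ i (sliceFluct ℓ j Ψ)) :=
    continuous_sliceMean ℓ i (continuous_sliceFluct ℓ j hΨ)
  exact lintegral_cellN_kernel_mul_mul_le hℓ hij hw h1 h2 hF hG
    (fun X z => sliceMean_update ℓ j _ X z) (fun X z => sliceMean_update ℓ i _ X z)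

end Literature.MathematicalPhysics.QuantumManyBody.JelliumBoseGas
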